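import Literature.Topology.FourManifolds.SurfaceGroupSymplecticRealisation
import Literature.Topology.FourManifolds.SymplecticPrimitiveVectors
import HarnessLib

/-!
# Stub `stub_pairRealisers` of line `saturated-torsor-descent` for crux
`CongruenceShadows.NilpotentShadowsStandard` (item stmt-SmoothPoincare4-14594)

**Realising one or two prescribed hyperbolic pairs by automorphisms of the surface group.**
`H₁ = ℤ^{Fin (g+3) × Bool}` (`(h, false) = aₕ`, `(h, true) = bₕ`) carries the intersection form
`ν = symplForm` (`ν(aₕ, bₕ) = 1`) and receives the surface group `S = S_{g+3}` through
`SurfaceGroup.abelianize`.  For letters `x, y` on different handles put `x* = (x.1, !x.2)` (the dual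
letter) and `ε = +1` if `x` is an `a`-letter, `-1` if a `b`-letter, so that `(δ_x, δ_y + ε δ_{x*})`
is a hyperbolic pair: `ν(δ_x, δ_y + ε δ_{x*}) = 1`.  The stub asks for an automorphism `σ` of `S` and
an isometry `F` of `(H₁, ν)` with `abelianize ∘ σ = F ∘ abelianize`, `F a₀ = δ_x`,
`F b₀ = δ_y + ε δ_{x*}` — and, for four letters `x, y, z, w` on four different handles, in addition
`F a₁ = δ_z`, `F b₁ = δ_w + ε_z δ_{z*}`.

Proof.  Work in the subgroup `R` of `ℤ`-linear automorphisms of `H₁` that are isometries of `ν`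
AND are induced by automorphisms of `S` (`exists_realisable_isometries`): it contains the
elementary moves `moveX/Y` (ZVC 3.6.9 (A)), `moveZ` (type (C)) and `moveW` with every integer
parameter (`Literature/…/SurfaceGroupSymplecticRealisation`: `exists_realises_move?_one`,
`moveW_one_eq`, `shear_mem`; `symplForm_move?`).  By the transitivity of the moves on hyperbolic
pairs (`exists_mem_apply_eq_single_pair`, ZVC 3.6.10) some `f ∈ R` carries
`(δ_x, δ_y + ε δ_{x*})` to `(a_{i₀}, b_{i₀})`; `F = f⁻¹ ∈ R` is the answer.  For two pairs, first
normalise the `x`-pair by `f₁ ∈ R`; the transported `z`-pair is `ν`-orthogonal to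
`(a_{i₀}, b_{i₀})`, i.e. supported off handle `i₀`, so the moves on the other handles inside
`R ⊓ Stab(a_{i₀}, b_{i₀})` (isometries fixing a handle preserve supports off it,
`apply_handle_eq_zero`) carry it to `(a_{i₁}, b_{i₁})` (`exists_mem_pair_fixing`); compose and
invert.  Mathlib + `Literature` only; no definitions, no named facts.

## References

* H. Zieschang, E. Vogt, H.-D. Coldewey, *Surfaces and Planar Discontinuous Groups*, LNM 835,
  Springer (1980), §3.6: Thm. 3.6.7 (b), 3.6.9, 3.6.10. [ZieschangVogtColdewey1980]
-/

-- the prescribed namespace `Summit.<P>.<Sub>.…` duplicates `SmoothPoincare4` (P = Sub)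
set_option linter.dupNamespace false

open scoped commutatorElement

noncomputable section

namespace Summit.SmoothPoincare4.SmoothPoincare4.Theorems.NilpotentShadowsStandard.SaturatedTorsorDescent

open Finset Multiplicative Literature.Topology.FourManifolds

namespace PairRealisers

section Pairs

variable {ι : Type*} [Fintype ι] [DecidableEq ι]

/-- Letters on different handles are `ν`-orthogonal: `ν(δ_x, δ_z) = 0` for `x.1 ≠ z.1`.
[folklore] -/
theorem symplForm_single_single_of_ne (x z : ι × Bool) (h : x.1 ≠ z.1) :
    symplForm (Pi.single x (1 : ℤ) : ι × Bool → ℤ) (Pi.single z 1) = 0 := by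
  obtain ⟨i, b⟩ := x
  obtain ⟨k, c⟩ := z
  dsimp only at h
  cases b
  · rw [symplForm_single_false_left, one_mul]
    exact Pi.single_eq_of_ne (fun e => h (Prod.mk.inj e).1) _
  · rw [symplForm_single_true_left, one_mul, neg_eq_zero]
    exact Pi.single_eq_of_ne (fun e => h (Prod.mk.inj e).1) _

/-- **The oriented pair is hyperbolic**: `ν(δ_x, δ_y + ε δ_{x*}) = 1` for letters `x, y` on
different handles (`x* = (x.1, !x.2)`, `ε = 1` for an `a`-letter `x`, `-1` for a `b`-letter).
[folklore] -/
theorem symplForm_single_partner (x y : ι × Bool) (h : x.1 ≠ y.1) :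
    symplForm (Pi.single x (1 : ℤ) : ι × Bool → ℤ)
      (Pi.single y 1 + (if x.2 = false then (1 : ℤ) else -1) • Pi.single (x.1, !x.2) 1) = 1 := by
  obtain ⟨i, b⟩ := x
  obtain ⟨k, c⟩ := y
  dsimp only at h ⊢
  have hne : ∀ b' : Bool, ((i, b') : ι × Bool) ≠ (k, c) := fun b' e => h (Prod.mk.inj e).1
  cases b
  · rw [symplForm_single_false_left, one_mul, Pi.add_apply, Pi.smul_apply,
      Pi.single_eq_of_ne (hne true)]
    simp
  · rw [symplForm_single_true_left, one_mul, Pi.add_apply, Pi.smul_apply,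
      Pi.single_eq_of_ne (hne false)]
    simp

/-- `ν(δ_x, δ_w + ε_z δ_{z*}) = 0` when `x` lies on neither the handle of `z` nor that of `w`.
[folklore] -/
theorem symplForm_single_partner_of_ne (x z w : ι × Bool) (hxz : x.1 ≠ z.1) (hxw : x.1 ≠ w.1) :
    symplForm (Pi.single x (1 : ℤ) : ι × Bool → ℤ)
      (Pi.single w 1 + (if z.2 = false then (1 : ℤ) else -1) • Pi.single (z.1, !z.2) 1) = 0 := by
  rw [map_add, map_smul, symplForm_single_single_of_ne x w hxw,
    symplForm_single_single_of_ne x (z.1, !z.2) hxz, smul_zero, add_zero]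

/-- Two oriented pairs on four different handles are `ν`-orthogonal:
`ν(δ_y + ε_x δ_{x*}, δ_w + ε_z δ_{z*}) = 0`. [folklore] -/
theorem symplForm_partner_partner (x y z w : ι × Bool) (hxz : x.1 ≠ z.1) (hxw : x.1 ≠ w.1)
    (hyz : y.1 ≠ z.1) (hyw : y.1 ≠ w.1) :
    symplForm (Pi.single y 1 + (if x.2 = false then (1 : ℤ) else -1) • Pi.single (x.1, !x.2) 1 :
        ι × Bool → ℤ)
      (Pi.single w 1 + (if z.2 = false then (1 : ℤ) else -1) • Pi.single (z.1, !z.2) 1) = 0 := by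
  rw [LinearMap.map_add₂, LinearMap.map_smul₂, symplForm_single_partner_of_ne y z w hyz hyw,
    symplForm_single_partner_of_ne (x.1, !x.2) z w hxz hxw, smul_zero, add_zero]

/-- **One hyperbolic pair** (ZVC 3.6.10 with all handles available): a subgroup `G` of
isometries containing all elementary moves carries any pair `ν(v, w) = 1` to
`(δ_{a_{i₀}}, δ_{b_{i₀}})`. [cite: ZieschangVogtColdewey1980, 3.6.10] -/
theorem exists_mem_pair (G : Subgroup ((ι × Bool → ℤ) ≃ₗ[ℤ] (ι × Bool → ℤ)))
    (hX : ∀ i c, moveX i c ∈ G) (hY : ∀ i c, moveY i c ∈ G)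
    (hZ : ∀ (i j : ι) (h : i ≠ j) (c : ℤ), moveZ i j h c ∈ G)
    (hW : ∀ i j : ι, i ≠ j → ∀ c : ℤ, moveW i j c ∈ G)
    (hiso : ∀ f ∈ G, ∀ u u', symplForm (f u) (f u') = symplForm u u') (i₀ : ι)
    (v w : ι × Bool → ℤ) (hvw : symplForm v w = 1) :
    ∃ f ∈ G, f v = Pi.single (i₀, false) 1 ∧ f w = Pi.single (i₀, true) 1 :=
  exists_mem_apply_eq_single_pair G univ i₀ (mem_univ _) (fun i _ c => hX i c)
    (fun i _ c => hY i c) (fun i _ j _ h c => hZ i j h c) (fun i _ j _ h c => hW i j h c) hiso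
    (fun _ _ _ _ _ hx => absurd (mem_univ _) hx) v w (fun _ hx => absurd (mem_univ _) hx)
    (fun _ hx => absurd (mem_univ _) hx) hvw

/-- **A second hyperbolic pair, fixing the first handle** (ZVC 3.6.10, the induction step): a
pair `ν(v, w) = 1` supported off handle `i₀` is carried to `(δ_{a_{i₁}}, δ_{b_{i₁}})`, `i₁ ≠ i₀`,
by an element of `G` fixing `δ_{a_{i₀}}` and `δ_{b_{i₀}}` — the moves on the handles `≠ i₀` inside
`G ⊓ Stab(δ_{a_{i₀}}, δ_{b_{i₀}})` do it, since isometries fixing handle `i₀` preserve supports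
off it. [cite: ZieschangVogtColdewey1980, 3.6.10] -/
theorem exists_mem_pair_fixing (G : Subgroup ((ι × Bool → ℤ) ≃ₗ[ℤ] (ι × Bool → ℤ)))
    (hX : ∀ i c, moveX i c ∈ G) (hY : ∀ i c, moveY i c ∈ G)
    (hZ : ∀ (i j : ι) (h : i ≠ j) (c : ℤ), moveZ i j h c ∈ G)
    (hW : ∀ i j : ι, i ≠ j → ∀ c : ℤ, moveW i j c ∈ G)
    (hiso : ∀ f ∈ G, ∀ u u', symplForm (f u) (f u') = symplForm u u')
    (i₀ i₁ : ι) (h01 : i₁ ≠ i₀) (v w : ι × Bool → ℤ) (hv0 : v (i₀, false) = 0)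
    (hv1 : v (i₀, true) = 0) (hw0 : w (i₀, false) = 0) (hw1 : w (i₀, true) = 0)
    (hvw : symplForm v w = 1) :
    ∃ f ∈ G, f (Pi.single (i₀, false) 1) = Pi.single (i₀, false) 1 ∧
      f (Pi.single (i₀, true) 1) = Pi.single (i₀, true) 1 ∧
      f v = Pi.single (i₁, false) 1 ∧ f w = Pi.single (i₁, true) 1 := by
  -- the stabiliser of `δ_{a_{i₀}}`, `δ_{b_{i₀}}`
  let Stab : Subgroup ((ι × Bool → ℤ) ≃ₗ[ℤ] (ι × Bool → ℤ)) :=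
    { carrier := {f | f (Pi.single (i₀, false) 1) = Pi.single (i₀, false) 1 ∧
          f (Pi.single (i₀, true) 1) = Pi.single (i₀, true) 1}
      mul_mem' := fun {f g} hf hg => by
        rw [Set.mem_setOf_eq] at hf hg ⊢
        rw [linearEquiv_mul_apply, linearEquiv_mul_apply, hg.1, hg.2]
        exact hf
      one_mem' := ⟨rfl, rfl⟩
      inv_mem' := fun {f} hf => by
        rw [Set.mem_setOf_eq] at hf ⊢
        constructor
        · conv_lhs => rw [← hf.1]
          rw [LinearEquiv.coe_inv, f.symm_apply_apply]
        · conv_lhs => rw [← hf.2]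
          rw [LinearEquiv.coe_inv, f.symm_apply_apply] }
  set G' := G ⊓ Stab with hG'
  -- basis vectors of handle `i₀` vanish on the other handles
  have hoff : ∀ i ∈ univ.erase i₀,
      (Pi.single (i₀, false) 1 : ι × Bool → ℤ) (i, false) = 0 ∧
      (Pi.single (i₀, false) 1 : ι × Bool → ℤ) (i, true) = 0 ∧
      (Pi.single (i₀, true) 1 : ι × Bool → ℤ) (i, false) = 0 ∧
      (Pi.single (i₀, true) 1 : ι × Bool → ℤ) (i, true) = 0 := by
    intro i hi
    have hi0 : i ≠ i₀ := ne_of_mem_erase hi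
    exact ⟨Pi.single_eq_of_ne (by simpa using hi0) _, Pi.single_eq_of_ne (by simp) _,
      Pi.single_eq_of_ne (by simp) _, Pi.single_eq_of_ne (by simpa using hi0) _⟩
  have hX' : ∀ i ∈ univ.erase i₀, ∀ c, moveX i c ∈ G' := by
    intro i hi c
    obtain ⟨-, h2, -, h4⟩ := hoff i hi
    exact Subgroup.mem_inf.2 ⟨hX i c, moveX_eq_self c h2, moveX_eq_self c h4⟩
  have hY' : ∀ i ∈ univ.erase i₀, ∀ c, moveY i c ∈ G' := by
    intro i hi c
    obtain ⟨h1, -, h3, -⟩ := hoff i hi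
    exact Subgroup.mem_inf.2 ⟨hY i c, moveY_eq_self c h1, moveY_eq_self c h3⟩
  have hZ' : ∀ i ∈ univ.erase i₀, ∀ l ∈ univ.erase i₀, ∀ (h : i ≠ l) (c : ℤ),
      moveZ i l h c ∈ G' := by
    intro i hi l hl h c
    obtain ⟨-, h2, -, h4⟩ := hoff i hi
    obtain ⟨h1', -, h3', -⟩ := hoff l hl
    exact Subgroup.mem_inf.2 ⟨hZ i l h c, moveZ_eq_self h c h1' h2, moveZ_eq_self h c h3' h4⟩
  have hW' : ∀ i ∈ univ.erase i₀, ∀ l ∈ univ.erase i₀, i ≠ l → ∀ c : ℤ, moveW i l c ∈ G' := by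
    intro i hi l hl h c
    obtain ⟨-, h2, -, h4⟩ := hoff i hi
    obtain ⟨-, h2', -, h4'⟩ := hoff l hl
    exact Subgroup.mem_inf.2 ⟨hW i l h c, moveW_eq_self c h2 h2', moveW_eq_self c h4 h4'⟩
  have hiso' : ∀ f ∈ G', ∀ u u', symplForm (f u) (f u') = symplForm u u' :=
    fun f hf => hiso f (Subgroup.mem_inf.1 hf).1
  have hstab' : ∀ f ∈ G', f (Pi.single (i₀, false) 1) = Pi.single (i₀, false) 1 ∧
      f (Pi.single (i₀, true) 1) = Pi.single (i₀, true) 1 :=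
    fun f hf => (Subgroup.mem_inf.1 hf).2
  have hmem : ∀ x : ι × Bool, x.1 ∉ univ.erase i₀ → x.1 = i₀ := fun x hx => by
    simpa using hx
  have h0 : i₀ ∉ univ.erase i₀ := by simp
  have hsupp' : ∀ f ∈ G', ∀ u : ι × Bool → ℤ, (∀ x : ι × Bool, x.1 ∉ univ.erase i₀ → u x = 0) →
      ∀ x : ι × Bool, x.1 ∉ univ.erase i₀ → f u x = 0 := by
    intro f hf u hu x hx
    obtain ⟨he, hf'⟩ := hstab' f hf
    obtain ⟨h1, h2⟩ := apply_handle_eq_zero f (hiso' f hf) i₀ he hf' u (hu (i₀, false) h0)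
      (hu (i₀, true) h0)
    obtain ⟨k, b⟩ := x
    obtain rfl : k = i₀ := hmem _ hx
    cases b
    · exact h1
    · exact h2
  have hv : ∀ x : ι × Bool, x.1 ∉ univ.erase i₀ → v x = 0 := by
    rintro ⟨k, b⟩ hx
    obtain rfl : k = i₀ := hmem _ hx
    cases b
    · exact hv0
    · exact hv1
  have hw : ∀ x : ι × Bool, x.1 ∉ univ.erase i₀ → w x = 0 := by
    rintro ⟨k, b⟩ hx
    obtain rfl : k = i₀ := hmem _ hx
    cases b
    · exact hw0
    · exact hw1
  obtain ⟨f, hf, hfv, hfw⟩ := exists_mem_apply_eq_single_pair G' (univ.erase i₀) i₁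
    (mem_erase.2 ⟨h01, mem_univ _⟩) hX' hY' hZ' hW' hiso' hsupp' v w hv hw hvw
  exact ⟨f, (Subgroup.mem_inf.1 hf).1, (hstab' f hf).1, (hstab' f hf).2, hfv, hfw⟩

/-- **Two hyperbolic pairs on four handles**: for letters `x, y, z, w` on four different handles
some `f ∈ G` carries `(δ_x, δ_y + ε_x δ_{x*})` to `(δ_{a_{i₀}}, δ_{b_{i₀}})` and
`(δ_z, δ_w + ε_z δ_{z*})` to `(δ_{a_{i₁}}, δ_{b_{i₁}})`: normalise the first pair, observe that the
transported second pair is `ν`-orthogonal to handle `i₀`, and normalise it inside the stabiliser.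
[cite: ZieschangVogtColdewey1980, 3.6.10] -/
theorem exists_mem_two_pairs (G : Subgroup ((ι × Bool → ℤ) ≃ₗ[ℤ] (ι × Bool → ℤ)))
    (hX : ∀ i c, moveX i c ∈ G) (hY : ∀ i c, moveY i c ∈ G)
    (hZ : ∀ (i j : ι) (h : i ≠ j) (c : ℤ), moveZ i j h c ∈ G)
    (hW : ∀ i j : ι, i ≠ j → ∀ c : ℤ, moveW i j c ∈ G)
    (hiso : ∀ f ∈ G, ∀ u u', symplForm (f u) (f u') = symplForm u u')
    (i₀ i₁ : ι) (h01 : i₁ ≠ i₀) (x y z w : ι × Bool) (hxy : x.1 ≠ y.1) (hxz : x.1 ≠ z.1)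
    (hxw : x.1 ≠ w.1) (hyz : y.1 ≠ z.1) (hyw : y.1 ≠ w.1) (hzw : z.1 ≠ w.1) :
    ∃ f ∈ G, f (Pi.single x 1) = Pi.single (i₀, false) 1 ∧
      f (Pi.single y 1 + (if x.2 = false then (1 : ℤ) else -1) • Pi.single (x.1, !x.2) 1) =
        Pi.single (i₀, true) 1 ∧
      f (Pi.single z 1) = Pi.single (i₁, false) 1 ∧
      f (Pi.single w 1 + (if z.2 = false then (1 : ℤ) else -1) • Pi.single (z.1, !z.2) 1) =
        Pi.single (i₁, true) 1 := by
  obtain ⟨f₁, hf₁, h₁x, h₁y⟩ := exists_mem_pair G hX hY hZ hW hiso i₀ _ _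
    (symplForm_single_partner x y hxy)
  have hiso₁ := hiso f₁ hf₁
  -- the transported second pair is supported off handle `i₀`
  have hv0 : f₁ (Pi.single z 1) (i₀, false) = 0 := by
    have := hiso₁ (Pi.single z 1)
      (Pi.single y 1 + (if x.2 = false then (1 : ℤ) else -1) • Pi.single (x.1, !x.2) 1)
    rw [h₁y, symplForm_single_true_right, mul_one,
      symplForm_single_partner_of_ne z x y hxz.symm hyz.symm] at this
    exact this
  have hv1 : f₁ (Pi.single z 1) (i₀, true) = 0 := by
    have := hiso₁ (Pi.single x 1) (Pi.single z 1)
    rw [h₁x, symplForm_single_false_left, one_mul, symplForm_single_single_of_ne x z hxz] at this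
    exact this
  have hw0 : f₁ (Pi.single w 1 + (if z.2 = false then (1 : ℤ) else -1) • Pi.single (z.1, !z.2) 1)
      (i₀, false) = 0 := by
    have := hiso₁
      (Pi.single w 1 + (if z.2 = false then (1 : ℤ) else -1) • Pi.single (z.1, !z.2) 1)
      (Pi.single y 1 + (if x.2 = false then (1 : ℤ) else -1) • Pi.single (x.1, !x.2) 1)
    rw [h₁y, symplForm_single_true_right, mul_one,
      symplForm_partner_partner z w x y hxz.symm hyz.symm hxw.symm hyw.symm] at this
    exact this
  have hw1 : f₁ (Pi.single w 1 + (if z.2 = false then (1 : ℤ) else -1) • Pi.single (z.1, !z.2) 1)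
      (i₀, true) = 0 := by
    have := hiso₁ (Pi.single x 1)
      (Pi.single w 1 + (if z.2 = false then (1 : ℤ) else -1) • Pi.single (z.1, !z.2) 1)
    rw [h₁x, symplForm_single_false_left, one_mul,
      symplForm_single_partner_of_ne x z w hxz hxw] at this
    exact this
  have hvw : symplForm (f₁ (Pi.single z 1))
      (f₁ (Pi.single w 1 + (if z.2 = false then (1 : ℤ) else -1) • Pi.single (z.1, !z.2) 1)) = 1 := by
    rw [hiso₁]
    exact symplForm_single_partner z w hzw
  obtain ⟨f₂, hf₂, h₂a, h₂b, h₂z, h₂w⟩ :=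
    exists_mem_pair_fixing G hX hY hZ hW hiso i₀ i₁ h01 _ _ hv0 hv1 hw0 hw1 hvw
  refine ⟨f₂ * f₁, G.mul_mem hf₂ hf₁, ?_, ?_, ?_, ?_⟩
  · rw [linearEquiv_mul_apply, h₁x, h₂a]
  · rw [linearEquiv_mul_apply, h₁y, h₂b]
  · rw [linearEquiv_mul_apply, h₂z]
  · rw [linearEquiv_mul_apply, h₂w]

end Pairs

/-- **The realisable isometries** (ZVC Thm. 3.6.7 (b) with 3.6.9): the `ℤ`-linear automorphisms
of `H₁(S_n; ℤ)` that preserve `ν` and are induced (through `abelianize`) by an automorphism of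
the surface group `S_n` form a subgroup containing every elementary move `moveX i c`,
`moveY i c` (type (A)), `moveZ i j c` (type (C)) and `moveW i j c` (`exists_realises_move?_one`,
`moveW_one_eq`, `shear_mem`; the moves are isometries, `symplForm_move?`).
[cite: ZieschangVogtColdewey1980, Thm. 3.6.7 (b)] -/
theorem exists_realisable_isometries (n : ℕ) :
    ∃ R : Subgroup ((surfaceGen n → ℤ) ≃ₗ[ℤ] (surfaceGen n → ℤ)),
      (∀ f ∈ R, ∃ σ : SurfaceGroup n ≃* SurfaceGroup n, ∀ s,
        toAdd (SurfaceGroup.abelianize n (σ s)) = f (toAdd (SurfaceGroup.abelianize n s))) ∧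
      (∀ f ∈ R, ∀ u u', symplForm (f u) (f u') = symplForm u u') ∧
      (∀ i c, moveX i c ∈ R) ∧ (∀ i c, moveY i c ∈ R) ∧
      (∀ (i j : Fin n) (h : i ≠ j) (c : ℤ), moveZ i j h c ∈ R) ∧
      ∀ i j : Fin n, i ≠ j → ∀ c : ℤ, moveW i j c ∈ R := by
  -- automorphisms of `H₁` induced by automorphisms of `S_n`
  let R₀ : Subgroup ((surfaceGen n → ℤ) ≃ₗ[ℤ] (surfaceGen n → ℤ)) :=
    { carrier := {f | ∃ σ : SurfaceGroup n ≃* SurfaceGroup n, ∀ s,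
        toAdd (SurfaceGroup.abelianize n (σ s)) = f (toAdd (SurfaceGroup.abelianize n s))}
      mul_mem' := fun {f f'} hf hf' => by
        obtain ⟨σ, hσ⟩ := hf
        obtain ⟨τ, hτ⟩ := hf'
        exact ⟨τ.trans σ, realises_mul hσ hτ⟩
      one_mem' := ⟨MulEquiv.refl _, fun s => rfl⟩
      inv_mem' := fun {f} hf => by
        obtain ⟨σ, hσ⟩ := hf
        exact ⟨σ.symm, realises_inv hσ⟩ }
  -- isometries of `ν`
  let Iso : Subgroup ((surfaceGen n → ℤ) ≃ₗ[ℤ] (surfaceGen n → ℤ)) :=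
    { carrier := {f | ∀ u u', symplForm (f u) (f u') = symplForm u u'}
      mul_mem' := fun {f g} hf hg u u' => by
        rw [Set.mem_setOf_eq] at hf hg
        rw [linearEquiv_mul_apply, linearEquiv_mul_apply, hf, hg]
      one_mem' := fun u u' => rfl
      inv_mem' := fun {f} hf u u' => by
        rw [Set.mem_setOf_eq] at hf
        rw [← hf (f⁻¹ u) (f⁻¹ u'), LinearEquiv.coe_inv, f.apply_symm_apply, f.apply_symm_apply] }
  have hX₀ : ∀ i c, moveX i c ∈ R₀ := fun i => shear_mem _ _ R₀ (exists_realises_moveX_one n i)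
  have hY₀ : ∀ i c, moveY i c ∈ R₀ := fun i => shear_mem _ _ R₀ (exists_realises_moveY_one n i)
  have hZ₀ : ∀ (i j : Fin n) (h : i ≠ j) (c : ℤ), moveZ i j h c ∈ R₀ := fun i j h =>
    shear_mem _ _ R₀ (exists_realises_moveZ_one n i j h)
  have hW₀ : ∀ i j : Fin n, i ≠ j → ∀ c : ℤ, moveW i j c ∈ R₀ := by
    intro i j h
    refine shear_mem _ _ R₀ ?_
    change moveW i j 1 ∈ R₀
    rw [moveW_one_eq h]
    exact R₀.mul_mem (R₀.mul_mem (R₀.mul_mem (R₀.mul_mem (hZ₀ i j h 1) (hX₀ j 1)) (hZ₀ i j h (-1)))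
      (hX₀ i (-1))) (hX₀ j (-1))
  exact ⟨R₀ ⊓ Iso, fun f hf => (Subgroup.mem_inf.1 hf).1, fun f hf => (Subgroup.mem_inf.1 hf).2,
    fun i c => Subgroup.mem_inf.2 ⟨hX₀ i c, fun u u' => symplForm_moveX i c u u'⟩,
    fun i c => Subgroup.mem_inf.2 ⟨hY₀ i c, fun u u' => symplForm_moveY i c u u'⟩,
    fun i j h c => Subgroup.mem_inf.2 ⟨hZ₀ i j h c, fun u u' => symplForm_moveZ h c u u'⟩,
    fun i j h c => Subgroup.mem_inf.2 ⟨hW₀ i j h c, fun u u' => symplForm_moveW h c u u'⟩⟩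

end PairRealisers

open PairRealisers in
/-- Stub 4e · **pair realisers**.  For every genus `g + 3` and letters `x, y` on different
handles there are an automorphism `σ` of the surface group `S_{g+3}` and an isometry `F` of
`(H₁ = ℤ^{Fin (g+3) × Bool}, ν)` with `abelianize ∘ σ = F ∘ abelianize`, `F[a₀] = δ_x` and
`F[b₀] = δ_y + ε δ_{x*}` (`x* = (x.1, !x.2)` the dual letter, `ε = +1` for an `a`-letter `x`, `-1`
for a `b`-letter); and for four letters `x, y, z, w` on four different handles additionally
`F[a₁] = δ_z`, `F[b₁] = δ_w + ε_z δ_{z*}`.  Proof: the realisable isometries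
(`exists_realisable_isometries`, ZVC 3.6.7 (b) / 3.6.9) contain the elementary moves, which act
transitively on hyperbolic pairs (ZVC 3.6.10, `exists_mem_pair`) and on pairs of orthogonal
hyperbolic pairs (`exists_mem_two_pairs`); invert the normalising element.
[cite: ZieschangVogtColdewey1980, Thm. 3.6.7 (b)] -/
theorem stub_pairRealisers : ∀ g : ℕ,
    (∀ x y : Fin (g + 3) × Bool, x.1 ≠ y.1 → ∃ (σ : Literature.Topology.FourManifolds.SurfaceGroup (g + 3) ≃* Literature.Topology.FourManifolds.SurfaceGroup (g + 3)) (F : (Fin (g + 3) × Bool → ℤ) ≃ₗ[ℤ] (Fin (g + 3) × Bool → ℤ)),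
      (∀ s, Multiplicative.toAdd (Literature.Topology.FourManifolds.SurfaceGroup.abelianize (g + 3) (σ s)) = F (Multiplicative.toAdd (Literature.Topology.FourManifolds.SurfaceGroup.abelianize (g + 3) s))) ∧
      (∀ v w, Literature.Topology.FourManifolds.symplForm (F v) (F w) = Literature.Topology.FourManifolds.symplForm v w) ∧
      F (Pi.single ((0 : Fin (g + 3)), false) 1) = Pi.single x 1 ∧
      F (Pi.single ((0 : Fin (g + 3)), true) 1) = Pi.single y 1 + (if x.2 = false then (1 : ℤ) else -1) • Pi.single (x.1, !x.2) 1) ∧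
    (∀ x y z w : Fin (g + 3) × Bool, x.1 ≠ y.1 → x.1 ≠ z.1 → x.1 ≠ w.1 → y.1 ≠ z.1 → y.1 ≠ w.1 → z.1 ≠ w.1 → ∃ (σ : Literature.Topology.FourManifolds.SurfaceGroup (g + 3) ≃* Literature.Topology.FourManifolds.SurfaceGroup (g + 3)) (F : (Fin (g + 3) × Bool → ℤ) ≃ₗ[ℤ] (Fin (g + 3) × Bool → ℤ)),
      (∀ s, Multiplicative.toAdd (Literature.Topology.FourManifolds.SurfaceGroup.abelianize (g + 3) (σ s)) = F (Multiplicative.toAdd (Literature.Topology.FourManifolds.SurfaceGroup.abelianize (g + 3) s))) ∧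
      (∀ v w, Literature.Topology.FourManifolds.symplForm (F v) (F w) = Literature.Topology.FourManifolds.symplForm v w) ∧
      F (Pi.single ((0 : Fin (g + 3)), false) 1) = Pi.single x 1 ∧
      F (Pi.single ((0 : Fin (g + 3)), true) 1) = Pi.single y 1 + (if x.2 = false then (1 : ℤ) else -1) • Pi.single (x.1, !x.2) 1 ∧
      F (Pi.single ((1 : Fin (g + 3)), false) 1) = Pi.single z 1 ∧
      F (Pi.single ((1 : Fin (g + 3)), true) 1) = Pi.single w 1 + (if z.2 = false then (1 : ℤ) else -1) • Pi.single (z.1, !z.2) 1) := by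
  intro g
  obtain ⟨R, hreal, hiso, hX, hY, hZ, hW⟩ := exists_realisable_isometries (g + 3)
  have h10 : (1 : Fin (g + 3)) ≠ 0 := fun h => by simpa using congrArg Fin.val h
  refine ⟨fun x y hxy => ?_, fun x y z w hxy hxz hxw hyz hyw hzw => ?_⟩
  · obtain ⟨f, hf, hfx, hfy⟩ :=
      exists_mem_pair R hX hY hZ hW hiso 0 _ _ (symplForm_single_partner x y hxy)
    obtain ⟨σ, hσ⟩ := hreal _ (R.inv_mem hf)
    refine ⟨σ, f⁻¹, hσ, hiso _ (R.inv_mem hf), ?_, ?_⟩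
    · rw [LinearEquiv.coe_inv, LinearEquiv.symm_apply_eq, hfx]
    · rw [LinearEquiv.coe_inv, LinearEquiv.symm_apply_eq, hfy]
  · obtain ⟨f, hf, hfx, hfy, hfz, hfw⟩ := exists_mem_two_pairs R hX hY hZ hW hiso 0 1 h10
      x y z w hxy hxz hxw hyz hyw hzw
    obtain ⟨σ, hσ⟩ := hreal _ (R.inv_mem hf)
    refine ⟨σ, f⁻¹, hσ, hiso _ (R.inv_mem hf), ?_, ?_, ?_, ?_⟩
    · rw [LinearEquiv.coe_inv, LinearEquiv.symm_apply_eq, hfx]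
    · rw [LinearEquiv.coe_inv, LinearEquiv.symm_apply_eq, hfy]
    · rw [LinearEquiv.coe_inv, LinearEquiv.symm_apply_eq, hfz]
    · rw [LinearEquiv.coe_inv, LinearEquiv.symm_apply_eq, hfw]

end Summit.SmoothPoincare4.SmoothPoincare4.Theorems.NilpotentShadowsStandard.SaturatedTorsorDescent

end
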